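import Summits.QuantumFields.YangMills.Theorems.BalabanUVNodesN15NeumannCubeSeam
import Summits.QuantumFields.YangMills.Theorems.BalabanUVNodesN15TwoGridEntry1
import HarnessLib

/-!
# Route «BalabanUVNodes» (K3⁷), node N15 = NE2, -a lane, PROGRAMME N file N-IIc: THE η-DEFECT LETTER OF THE NEUMANN CUBE PROPAGATORS AT `U ≡ 1` — dag-n15-c FILE 45's `hDG` (and
# `hG′` at the fine spacing), HYPOTHESIS-FREE on the torus family, with King's η-RATE `(L^k)^{−γ∕2}`

Cell `pub-ymgap`, seat `pub-ymgap-dag-n15-a` (KNIT-BY-NAME, g19; D-0062; chair R424 venue; `bears_on: R4∕N15`); `--kind proof --supports stmt-QuantumFields-20544 --as helper`.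
Sequel of N-IIb `…N15NeumannCubeSeam`; inputs BY NAME: dag-n15-c part 52 `hasMaj_twoGridDefect` (the torus pair's entry 0 with rate), `hasMaj_entries110`∕`hasMaj_gOp_of_ineq`∕
`ineq110_114_pair` ((1.110) at any spacing), `hasMaj_pull_comp₂`, `hasMaj_rate_mono`; N-IIIb `hasMaj_chiCube_reflSet_comp`∕`hasMaj_chiCube_symOp_comp` (mirror images are farther).
CONSUMER: dag-n15-c FILE 45 `hasMaj_idef_parametrix`∕`hasMaj_idef_glued_of_cubes` with `G_i := mulOp χ_□ ∘ neumannCubeG … c_i …`, `S_i :=` the cube's blocks, `π := kingPrV L k r M`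
(their `blk ∘ π` is `fun i ↦ blockOf (L^r·L^k) M i.1` by `blkFine_comp_kingPrV`): `hG` = N-IIIb `hasMaj_chiCube_neumannCubeG`, `hG′` = `hasMaj_chiCube_neumannCubeG_fine` below,
`hloc` = N-IIIa `mulOp_comp_deltaOp_comp_neumannCubeG`, `hDG` = ★★★ `hasMaj_idef_chiCube_neumannCubeG` below.

WHAT.  §16 `hasMaj_comp_mulOp_chiCube` (source localization by the block cut, any target norm), `hasMaj_mulOp_comp_of_abs_le_one`, ★ `hasMaj_ownDiff_comp` (the own-direction
difference costs `η = 1∕n` against the `η⁻¹`-normalised gradient letters: `D∘T ≤ (d+1)(C∕n)e^{−δd}`), ★ `hasMaj_faceTerm`, ★★★ `hasMaj_idef_chiCube_neumannCubeG_of` (ANY torus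
`M_ν = 2S`, any `n = L^k`, `n′ = L^r·n`: torus defect `C₀e^{−δd}` + coarse gradients `C₁e^{−δd}` ⟹ `𝔇(G′_□, G_□) ≤ 1_□1_□·2^{d+1}e^{δ}(C₀ + (d+1)C₁∕L^k)·e^{−δd}`),
★★ `hasMaj_chiCube_neumannCubeG_of_ineq`∕`hasMaj_chiCube_neumannCubeG_fine` (the cube letter at ANY spacing from (1.110) — the fine member's `hG′`), ★★ `hasMaj_chiCube_grad_neumannCubeG_of`∕
`hasMaj_chiCube_grad_neumannCubeG_fine` (ENTRY 1 `χ_□ ∘ ∇_ν ∘ G(□)` at any spacing — the fine member's cube entry for FILES 46∕52), ★★★ `hasMaj_idef_chiCube_neumannCubeG`: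
for odd `L ≥ 3`, `a > 0`, `0 < γ < 1`: `∃ δ m > 0, ∀ m_T k r (k ≥ 1) c`, `𝔇(G′_□, G_□) ≤ 1_□(y)1_□(y′)·m·(L^k)^{−γ∕2}·e^{−δ|y−y′|_T}` (King's prolongation both sides; the faces cost
`L^{−k} ≤ (L^k)^{−γ∕2}`).
HONEST FRAMING.  Block-majorant bookkeeping over landed torus letters; no new analytic estimate; `U ≡ 1` torus MODEL of [B5] §1 on the doubled-cube family `M_ν = 2L^{m_T}`; the
commutator letters `hK`∕`hDK` of FILE 45 stay dag-n15-c's (their Leibniz files 46∕52 read this lane's entries); nothing of [B6] (2.38)–(2.40) ∕ [B9] Thm 3.14 asserted; N15 NOT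
discharged (object-bound; NE2⁺ NOT PRINTED); counts UNMOVED (typed 28∕28 · discharged 5∕27); one finite torus pair per index — NOT continuum ∕ ℝ⁴ ∕ OS ∕ mass gap ∕ Clay.  Theorems only.
-/

noncomputable section

open scoped BigOperators Matrix
open Finset

namespace Summit.QuantumFields.YangMills.BalabanUVNodes.N15.TwoGrid

open Literature.MathematicalPhysics.QuantumFieldTheory.Balaban1983to89
open Literature.MathematicalPhysics.QuantumFieldTheory.Balaban1983to89.B5Prop11Plancherel (Tor fine unitVec)
open Literature.MathematicalPhysics.QuantumFieldTheory.Balaban1983to89.B5Block118 (up bpt upHom upHom_intCast)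
open Literature.MathematicalPhysics.QuantumFieldTheory.Balaban1983to89.B6Prop26Gluing (mulOp mulOp_apply ind ind_nonneg ind_le_one)
open Literature.MathematicalPhysics.QuantumFieldTheory.King1986.Torus (blockOf tdistT)
open Literature.MathematicalPhysics.QuantumFieldTheory.Balaban1983to89.B11SectG (BlockNorm HasMaj)
open Literature.MathematicalPhysics.QuantumFieldTheory.Balaban1983to89.B6UnitTorusCarrier (unitTorusGeo)
open Literature.MathematicalPhysics.QuantumFieldTheory.Balaban1983to89.B5SiteBridgeP12 (MP)
open Literature.MathematicalPhysics.QuantumFieldTheory.Balaban1983to89.T4EtaRateDefect (idef idef_comp)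
open Literature.MathematicalPhysics.QuantumFieldTheory.Balaban1983to89.T4EtaRateCoeffDefect (pull pull_apply)
open Literature.MathematicalPhysics.QuantumFieldTheory.Balaban1983to89.B5SettingP12Real (latticeSettingP12R)
open Summit.QuantumFields.YangMills.BalabanUVNodes.N15.VectorPiece (blkFine kingPr kingPrV blkFine_comp_kingPrV bshiftV bshiftV_apply hasMaj_bshiftV_comp)

variable {d : ℕ}

/-! ## §16 LETTERS: cube propagators at ANY spacing from (1.110); the face terms; THE η-DEFECT OF THE CUBE-LOCALIZED NEUMANN PROPAGATORS -/

section Letters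

open Literature.MathematicalPhysics.QuantumFieldTheory.Balaban1983to89.B11AxialTransport190 (abs_le_loc_ofBlocks loc_ofBlocks_le)

variable {L : ℕ} {M : Fin (d + 1) → ℕ} [∀ μ, NeZero (M μ)] {k n : ℕ} [NeZero n] {c : Tor M} {S : ℕ}

/-- ★ SOURCE LOCALIZATION BY THE BLOCK CUT: an operator with a nonnegative block majorant, fed through `χ_□`, is localized at the cube's blocks (any target norm). [folklore] -/
theorem hasMaj_comp_mulOp_chiCube {F₂ : Type} [AddCommGroup F₂] [Module ℝ F₂] {b₂ : BlockNorm (unitTorusGeo L k M) F₂}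
    {T : (Tor (fine n M) × Fin (d + 1) → ℝ) →ₗ[ℝ] F₂} {K : Tor M → Tor M → ℝ} (hK : ∀ y y', 0 ≤ K y y')
    (hT : HasMaj (BlockNorm.ofBlocks (unitTorusGeo L k M) (fun b : Tor (fine n M) × Fin (d + 1) => blockOf n M b.1)) b₂ T K) :
    HasMaj (BlockNorm.ofBlocks (unitTorusGeo L k M) (fun b : Tor (fine n M) × Fin (d + 1) => blockOf n M b.1)) b₂ (T ∘ₗ mulOp (chiCube M n c S))
      (fun y y' => ind (cubeBlocks M c S : Set (Tor M)) y' * K y y') := by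
  classical
  intro y' μ hμ y
  dsimp only
  set blk := fun b : Tor (fine n M) × Fin (d + 1) => blockOf n M b.1 with hblk
  have hμ' : (BlockNorm.ofBlocks (unitTorusGeo L k M) blk).IsLoc y' (mulOp (chiCube M n c S) μ) := by
    intro b hb; show chiCube M n c S b * μ b = 0; rw [hμ b hb, mul_zero]
  by_cases hy' : y' ∈ cubeBlocks M c S
  · have hi : ind (cubeBlocks M c S : Set (Tor M)) y' = 1 := by simp [ind, hy']
    rw [hi, one_mul, LinearMap.comp_apply]
    refine (hT y' _ hμ' y).trans (mul_le_mul_of_nonneg_left ?_ (hK y y'))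
    refine loc_ofBlocks_le (g := unitTorusGeo L k M) blk _ ((BlockNorm.ofBlocks (unitTorusGeo L k M) blk).loc_nonneg y' μ) fun b hb => ?_
    rw [mulOp_apply, abs_mul]
    exact (mul_le_of_le_one_left (abs_nonneg _) (abs_chiCube_le_one S b)).trans (abs_le_loc_ofBlocks (g := unitTorusGeo L k M) blk μ hb)
  · have hzero : mulOp (chiCube M n c S) μ = 0 := by
      funext b
      rw [mulOp_apply, Pi.zero_apply]
      by_cases hb : blk b = y'
      · have hb' : blockOf n M b.1 ∉ cubeBlocks M c S := by rw [show blockOf n M b.1 = y' from hb]; exact hy'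
        rw [chiCube_of_not_mem hb', zero_mul]
      · rw [hμ b hb, mul_zero]
    rw [LinearMap.comp_apply, hzero, map_zero, b₂.loc_zero]
    exact mul_nonneg (mul_nonneg (ind_nonneg _ _) (hK y y')) ((BlockNorm.ofBlocks (unitTorusGeo L k M) blk).loc_nonneg y' μ)

/-- A BOUNDED DIAGONAL ON THE LEFT costs nothing: `|m| ≤ 1` ⟹ `M_m ∘ T` keeps a nonnegative majorant. [folklore] -/
theorem hasMaj_mulOp_comp_of_abs_le_one {g : B6.Geometry} {X F₁ : Type} [Fintype X] [AddCommGroup F₁] [Module ℝ F₁] {b₁ : BlockNorm g F₁} (blk : X → g.Site)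
    {T : F₁ →ₗ[ℝ] (X → ℝ)} {K : g.Site → g.Site → ℝ} {m : X → ℝ} (hm : ∀ x, |m x| ≤ 1) (hK : ∀ y y', 0 ≤ K y y') (h : HasMaj b₁ (BlockNorm.ofBlocks g blk) T K) :
    HasMaj b₁ (BlockNorm.ofBlocks g blk) (mulOp m ∘ₗ T) K := by
  intro y' μ hμ y
  refine loc_ofBlocks_le blk _ (mul_nonneg (hK y y') (b₁.loc_nonneg y' μ)) fun x hx => ?_
  rw [LinearMap.comp_apply, mulOp_apply, abs_mul]
  exact (mul_le_of_le_one_left (abs_nonneg _) (hm x)).trans ((abs_le_loc_ofBlocks blk _ hx).trans (h y' μ hμ y))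

/-- ★ **THE OWN-DIRECTION DIFFERENCE COSTS `η = 1∕n`** against the `η⁻¹`-normalised gradient letters: `ρ(n(s_ν − 1))∘T ≤ C·e^{−δd}` for every `ν` ⟹ `D∘T ≤ (d+1)·(C∕n)·e^{−δd}`.
[cite: Balaban1984PropagatorsI, Prop. 1.2 (1.110) p.35 (the gradient entry, `η⁻¹`-normalised)] -/
theorem hasMaj_ownDiff_comp {F₁ : Type} [AddCommGroup F₁] [Module ℝ F₁] {b₁ : BlockNorm (unitTorusGeo L k M) F₁} {T : F₁ →ₗ[ℝ] (Tor (fine n M) × Fin (d + 1) → ℝ)}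
    {C δ : ℝ} (hC : 0 ≤ C)
    (h : ∀ ν, HasMaj b₁ (BlockNorm.ofBlocks (unitTorusGeo L k M) (fun b : Tor (fine n M) × Fin (d + 1) => blockOf n M b.1)) (symbOp M n (sD M n ν (n : ℝ)) ∘ₗ T)
      (fun y y' => C * Real.exp (-(δ * tdistT M y y')))) :
    HasMaj b₁ (BlockNorm.ofBlocks (unitTorusGeo L k M) (fun b : Tor (fine n M) × Fin (d + 1) => blockOf n M b.1)) (ownDiff M n ∘ₗ T)
      (fun y y' => (d + 1) * (C / n) * Real.exp (-(δ * tdistT M y y'))) := by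
  have hn0 : (n : ℝ) ≠ 0 := by exact_mod_cast NeZero.ne n
  have hK0 : ∀ y y' : Tor M, 0 ≤ C * Real.exp (-(δ * tdistT M y y')) := fun y y' => mul_nonneg hC (Real.exp_nonneg _)
  have hsD : ∀ ν, sD M n ν 1 = (n : ℝ)⁻¹ • sD M n ν (n : ℝ) := by
    intro ν; rw [sD, sD, smul_smul, inv_mul_cancel₀ hn0]
  have hterm : ∀ ν, HasMaj b₁ (BlockNorm.ofBlocks (unitTorusGeo L k M) (fun b : Tor (fine n M) × Fin (d + 1) => blockOf n M b.1))
      ((mulOp (fun b : Tor (fine n M) × Fin (d + 1) => if b.2 = ν then (1 : ℝ) else 0) ∘ₗ symbOp M n (sD M n ν 1)) ∘ₗ T)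
      (fun y y' => |(n : ℝ)⁻¹| * (C * Real.exp (-(δ * tdistT M y y')))) := by
    intro ν
    rw [LinearMap.comp_assoc, hsD ν, map_smul, LinearMap.smul_comp]
    exact hasMaj_mulOp_comp_of_abs_le_one _ (fun b => by split_ifs <;> simp) (fun y y' => mul_nonneg (abs_nonneg _) (hK0 y y'))
      (hasMaj_smul_ofBlocks _ hK0 _ (h ν))
  rw [ownDiff, fsum_comp]
  refine (hasMaj_finsum _ _ _ fun ν _ => hterm ν).mono fun y y' => le_of_eq ?_
  rw [Finset.sum_const, Finset.card_univ, Fintype.card_fin, nsmul_eq_mul, abs_inv, Nat.abs_cast]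
  push_cast
  ring

variable [NeZero L] {r : ℕ}

/-- ★ **ONE FACE TERM**: `M_{mask_T} ∘ P ∘ (M_{χ_□} ∘ R_T ∘ X) ≤ 1_□(y)·1_□(y′)·Ce^{δ}·e^{−δd}` from `X ≤ 1_□(y′)·C·e^{−δd}` — mirror images are farther (`hasMaj_chiCube_reflSet_comp`), the pairing
reads blocks (`hasMaj_pull_comp₂`), the mask is a bounded diagonal. [cite: Balaban1984PropagatorsII, (2.37) p.229 (images); King1986, p.664 (pairing)] -/
theorem hasMaj_faceTerm {F₁ : Type} [AddCommGroup F₁] [Module ℝ F₁] (hM : ∀ ν, M ν = 2 * S) {C δ : ℝ} (hC : 0 ≤ C) (hδ : 0 ≤ δ) (T : Finset (Fin (d + 1)))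
    {b₁ : BlockNorm (unitTorusGeo L k M) F₁} {X : F₁ →ₗ[ℝ] (Tor (fine (L ^ k) M) × Fin (d + 1) → ℝ)}
    (hX : HasMaj b₁ (BlockNorm.ofBlocks (unitTorusGeo L k M) (fun b : Tor (fine (L ^ k) M) × Fin (d + 1) => blockOf (L ^ k) M b.1)) X
      (fun y y' => ind (cubeBlocks M c S : Set (Tor M)) y' * (C * Real.exp (-(δ * tdistT M y y'))))) :
    HasMaj b₁ (BlockNorm.ofBlocks (unitTorusGeo L k M) (fun b' : Tor (fine (L ^ r * L ^ k) M) × Fin (d + 1) => blockOf (L ^ r * L ^ k) M b'.1))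
      (mulOp (faceMask M (L ^ r * L ^ k) (L ^ r) T) ∘ₗ pull (kingPrV L k r M) ∘ₗ (mulOp (chiCube M (L ^ k) c S) ∘ₗ reflSet M (L ^ k) c T ∘ₗ X))
      (fun y y' => ind (cubeBlocks M c S : Set (Tor M)) y * ind (cubeBlocks M c S : Set (Tor M)) y' * (C * Real.exp δ * Real.exp (-(δ * tdistT M y y')))) := by
  have hK0 : ∀ y y' : Tor M, 0 ≤ ind (g := unitTorusGeo L k M) (cubeBlocks M c S : Set (Tor M)) y * ind (g := unitTorusGeo L k M) (cubeBlocks M c S : Set (Tor M)) y' *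
      (C * Real.exp δ * Real.exp (-(δ * tdistT M y y'))) :=
    fun y y' => mul_nonneg (mul_nonneg (ind_nonneg _ _) (ind_nonneg _ _)) (by positivity)
  have hblk : ∀ x : Tor (fine (L ^ r * L ^ k) M) × Fin (d + 1), blockOf (L ^ k) M (kingPrV L k r M x).1 = blockOf (L ^ r * L ^ k) M x.1 := fun x =>
    congrFun (blkFine_comp_kingPrV M L k r) x
  have h1 := hasMaj_chiCube_reflSet_comp hC hδ hM T hX
  have h2 := hasMaj_pull_comp₂ (b₁ := b₁) (fun b : Tor (fine (L ^ k) M) × Fin (d + 1) => blockOf (L ^ k) M b.1)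
    (fun b' : Tor (fine (L ^ r * L ^ k) M) × Fin (d + 1) => blockOf (L ^ r * L ^ k) M b'.1) (kingPrV L k r M) hK0
    (fun x y' => by rw [hblk x]) h1
  exact hasMaj_mulOp_comp_of_abs_le_one _ (abs_faceMask_le_one _ T) hK0 h2

/-- ★★★ **THE η-DEFECT OF THE CUBE-LOCALIZED NEUMANN PROPAGATORS FROM TWO TORUS LETTERS** (any torus `M_ν = 2S`, any coarse scale `n = L^k`, any refinement `n′ = L^r·n`): if the torus pair has
the two-grid defect `𝔇(G′, G) ≤ C₀·e^{−δd}` (entry 0 of [B9] (3.42), King's prolongation on both sides) and the coarse gradients `∇_νG ≤ C₁·e^{−δd}` ((1.110)), then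
`𝔇(G′_□, G_□) ≤ 1_□(y)·1_□(y′)·2^{d+1}e^{δ}·(C₀ + (d+1)·C₁∕L^k)·e^{−δd}` — dag-n15-c FILE 45's `hDG` letter shape, with the smallness `C₀` of the torus defect plus ONE `η = L^{−k}` from the faces.
[cite: Balaban1985BackgroundPropagators, Thm 3.14 pp.426–427 (difference template), (3.42) p.397; Balaban1984PropagatorsII, (2.133) p.247 (shape), (2.37) p.229] -/
theorem hasMaj_idef_chiCube_neumannCubeG_of (hM : ∀ ν, M ν = 2 * S) {a : ℝ} (ha : 0 < a) {C₀ C₁ δ : ℝ} (hC₀ : 0 ≤ C₀) (hC₁ : 0 ≤ C₁) (hδ : 0 ≤ δ)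
    (h0 : HasMaj (BlockNorm.ofBlocks (unitTorusGeo L k M) (fun b : Tor (fine (L ^ k) M) × Fin (d + 1) => blockOf (L ^ k) M b.1))
      (BlockNorm.ofBlocks (unitTorusGeo L k M) (fun b' : Tor (fine (L ^ r * L ^ k) M) × Fin (d + 1) => blockOf (L ^ r * L ^ k) M b'.1))
      (idef (pull (kingPrV L k r M)) (pull (kingPrV L k r M)) (gOp M (L ^ r * L ^ k) a) (gOp M (L ^ k) a)) (fun y y' => C₀ * Real.exp (-(δ * tdistT M y y'))))
    (h1 : ∀ ν, HasMaj (BlockNorm.ofBlocks (unitTorusGeo L k M) (fun b : Tor (fine (L ^ k) M) × Fin (d + 1) => blockOf (L ^ k) M b.1))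
      (BlockNorm.ofBlocks (unitTorusGeo L k M) (fun b : Tor (fine (L ^ k) M) × Fin (d + 1) => blockOf (L ^ k) M b.1))
      (symbOp M (L ^ k) (sD M (L ^ k) ν ((L ^ k : ℕ) : ℝ)) ∘ₗ gOp M (L ^ k) a) (fun y y' => C₁ * Real.exp (-(δ * tdistT M y y')))) :
    HasMaj (BlockNorm.ofBlocks (unitTorusGeo L k M) (fun b : Tor (fine (L ^ k) M) × Fin (d + 1) => blockOf (L ^ k) M b.1))
      (BlockNorm.ofBlocks (unitTorusGeo L k M) (fun b' : Tor (fine (L ^ r * L ^ k) M) × Fin (d + 1) => blockOf (L ^ r * L ^ k) M b'.1))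
      (idef (pull (kingPrV L k r M)) (pull (kingPrV L k r M))
        (mulOp (chiCube M (L ^ r * L ^ k) c S) ∘ₗ neumannCubeG M (L ^ r * L ^ k) c S a) (mulOp (chiCube M (L ^ k) c S) ∘ₗ neumannCubeG M (L ^ k) c S a))
      (fun y y' => ind (cubeBlocks M c S : Set (Tor M)) y * ind (cubeBlocks M c S : Set (Tor M)) y' *
        (2 ^ (d + 1) * Real.exp δ * (C₀ + (d + 1) * (C₁ / (L ^ k : ℕ))) * Real.exp (-(δ * tdistT M y y')))) := by
  rw [idef_chiCube_neumannCubeG L k r c S a hM ha]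
  -- the torus defect dressed by the images
  have hT1 := hasMaj_chiCube_symOp_comp hC₀ hδ hM (hasMaj_comp_mulOp_chiCube (c := c) (S := S) (fun y y' => mul_nonneg hC₀ (Real.exp_nonneg _)) h0)
  -- the face terms: one own-direction coarse difference of `G`, source-localized, reflected, paired, masked
  have hD := hasMaj_ownDiff_comp hC₁ h1
  have hX : HasMaj (BlockNorm.ofBlocks (unitTorusGeo L k M) (fun b : Tor (fine (L ^ k) M) × Fin (d + 1) => blockOf (L ^ k) M b.1))
      (BlockNorm.ofBlocks (unitTorusGeo L k M) (fun b : Tor (fine (L ^ k) M) × Fin (d + 1) => blockOf (L ^ k) M b.1))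
      (ownDiff M (L ^ k) ∘ₗ gOp M (L ^ k) a ∘ₗ mulOp (chiCube M (L ^ k) c S))
      (fun y y' => ind (cubeBlocks M c S : Set (Tor M)) y' * ((d + 1) * (C₁ / (L ^ k : ℕ)) * Real.exp (-(δ * tdistT M y y')))) :=
    (hasMaj_comp_mulOp_chiCube (c := c) (S := S) (fun y y' => by positivity) hD).congr fun μ => rfl
  have hsum := hasMaj_finsum (Finset.univ : Finset (Fin (d + 1))).powerset _ _ fun T _ =>
    hasMaj_faceTerm (r := r) (c := c) hM (by positivity : (0 : ℝ) ≤ (d + 1) * (C₁ / (L ^ k : ℕ))) hδ T hX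
  refine (hT1.add hsum).mono fun y y' => le_of_eq ?_
  rw [Finset.sum_const, Finset.card_powerset, Finset.card_univ, Fintype.card_fin, nsmul_eq_mul]
  push_cast
  ring

omit [NeZero L] in
/-- ★★ **THE NEUMANN CUBE PROPAGATOR'S LETTER AT ANY SPACING FROM (1.110)** (the `hG`∕`hG′` shape of dag-n15-c FILE 45, both members): `χ_□ ∘ G(□ + c) ≤ 1_□1_□·2^{d+1}Ce^{δ₀}·e^{−δ₀d}`.
[cite: Balaban1984PropagatorsII, (2.133) p.247 (shape), (2.37) p.229; Balaban1984PropagatorsI, Prop. 1.2 (1.110) p.35] -/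
theorem hasMaj_chiCube_neumannCubeG_of_ineq (hn : 1 ≤ n) (hM : ∀ ν, M ν = 2 * S) {a : ℝ} {K : ℕ} {C δ₀ : ℝ} {Cα Cε : ℝ → ℝ} {Cαε : ℝ → ℝ → ℝ}
    (H : B5.Ineq110_114 (latticeSettingP12R n M a K) C Cα Cε Cαε δ₀) (hC : 0 ≤ C) (hδ₀ : 0 ≤ δ₀) (c : Tor M) :
    HasMaj (BlockNorm.ofBlocks (unitTorusGeo L k M) (fun b : Tor (fine n M) × Fin (d + 1) => blockOf n M b.1))
      (BlockNorm.ofBlocks (unitTorusGeo L k M) (fun b : Tor (fine n M) × Fin (d + 1) => blockOf n M b.1))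
      (mulOp (chiCube M n c S) ∘ₗ neumannCubeG M n c S a)
      (fun y y' => ind (cubeBlocks M c S : Set (Tor M)) y * ind (cubeBlocks M c S : Set (Tor M)) y' * (2 ^ (d + 1) * (C * Real.exp δ₀) * Real.exp (-(δ₀ * tdistT M y y')))) :=
  hasMaj_chiCube_symOp_comp hC hδ₀ hM (hasMaj_comp_mulOp_chiInt (c := c) (S := S) hC (hasMaj_gOp_of_ineq (L := L) (k := k) M n a hn H hC))

/-- ★★ **THE FINE MEMBER's LETTER** (`hG′` of dag-n15-c FILE 45 for the Neumann cubes of the torus family at `n′ = L^r·L^k`, blocks read through King's pairing), uniform in every index.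
[cite: Balaban1984PropagatorsII, (2.133) p.247 (shape); Balaban1984PropagatorsI, Prop. 1.2 (1.110) p.35] -/
theorem hasMaj_chiCube_neumannCubeG_fine (hL : Odd L ∧ 1 < L) {a : ℝ} (ha : 0 < a) :
    ∃ δ β : ℝ, 0 < δ ∧ 0 < β ∧ ∀ (mT k r : ℕ) (hk : 1 ≤ k) (c : Tor (MP (paramsOf d L mT k hL))),
      HasMaj (BlockNorm.ofBlocks (unitTorusGeo L k (MP (paramsOf d L mT k hL)))
          (fun i : Tor (fine (L ^ r * L ^ k) (MP (paramsOf d L mT k hL))) × Fin (d + 1) => blockOf (L ^ r * L ^ k) (MP (paramsOf d L mT k hL)) i.1))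
        (BlockNorm.ofBlocks (unitTorusGeo L k (MP (paramsOf d L mT k hL)))
          (fun i : Tor (fine (L ^ r * L ^ k) (MP (paramsOf d L mT k hL))) × Fin (d + 1) => blockOf (L ^ r * L ^ k) (MP (paramsOf d L mT k hL)) i.1))
        (mulOp (chiCube (MP (paramsOf d L mT k hL)) (L ^ r * L ^ k) c (L ^ mT)) ∘ₗ neumannCubeG (MP (paramsOf d L mT k hL)) (L ^ r * L ^ k) c (L ^ mT) a)
        (fun y y' => ind ((cubeBlocks (MP (paramsOf d L mT k hL)) c (L ^ mT) : Finset _) : Set _) y *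
          ind ((cubeBlocks (MP (paramsOf d L mT k hL)) c (L ^ mT) : Finset _) : Set _) y' * (β * Real.exp (-(δ * tdistT (MP (paramsOf d L mT k hL)) y y')))) := by
  obtain ⟨δ₀, C, Cα, Cε, Cαε, hδ₀, hC, H⟩ := ineq110_114_pair (d := d) hL ha
  refine ⟨δ₀, 2 ^ (d + 1) * (C * Real.exp δ₀), hδ₀, by positivity, fun mT k r hk c => ?_⟩
  have hn' : 1 ≤ L ^ r * L ^ k := Nat.one_le_iff_ne_zero.mpr (Nat.mul_ne_zero (pow_ne_zero r (NeZero.ne L)) (pow_ne_zero k (NeZero.ne L)))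
  exact hasMaj_chiCube_neumannCubeG_of_ineq hn' (fun ν => rfl) (H mT k r hk).2 hC.le hδ₀.le c

omit [NeZero L] in
/-- ★★ **ENTRY 1 OF THE NEUMANN CUBE PROPAGATOR AT ANY SPACING** (N-IIIc `hasMaj_chiCube_grad_neumannCubeG` with the torus letter as a HYPOTHESIS, any torus `M_ν = 2S`, any `n`):
`∇_νG ≤ C·e^{−δ₀d}` on the torus ⟹ `χ_□ ∘ ∇_ν ∘ G(□ + c) ≤ 1_□1_□·2^{d+1}Ce^{2δ₀}·e^{−δ₀d}`. [cite: Balaban1984PropagatorsII, (2.133) p.247 (shape), (2.37) p.229; Balaban1984PropagatorsI, Prop. 1.2 (1.110) p.35] -/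
theorem hasMaj_chiCube_grad_neumannCubeG_of (hM : ∀ ν, M ν = 2 * S) {a C δ₀ : ℝ} (hC : 0 < C) (hδ₀ : 0 < δ₀) (ν : Fin (d + 1))
    (hD : HasMaj (BlockNorm.ofBlocks (unitTorusGeo L k M) (fun b : Tor (fine n M) × Fin (d + 1) => blockOf n M b.1))
      (BlockNorm.ofBlocks (unitTorusGeo L k M) (fun b : Tor (fine n M) × Fin (d + 1) => blockOf n M b.1))
      (symbOp M n (sD M n ν (n : ℝ)) ∘ₗ gOp M n a) (fun y y' => C * Real.exp (-(δ₀ * tdistT M y y')))) :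
    HasMaj (BlockNorm.ofBlocks (unitTorusGeo L k M) (fun b : Tor (fine n M) × Fin (d + 1) => blockOf n M b.1))
      (BlockNorm.ofBlocks (unitTorusGeo L k M) (fun b : Tor (fine n M) × Fin (d + 1) => blockOf n M b.1))
      (mulOp (chiCube M n c S) ∘ₗ symbOp M n (sD M n ν (n : ℝ)) ∘ₗ neumannCubeG M n c S a)
      (fun y y' => ind (cubeBlocks M c S : Set (Tor M)) y * ind (cubeBlocks M c S : Set (Tor M)) y' *
        (2 ^ (d + 1) * (C * Real.exp δ₀ * Real.exp δ₀) * Real.exp (-(δ₀ * tdistT M y y')))) := by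
  -- per image: `∇^{(T)} ∘ G ∘ χ°` source-localized with cost `e^{δ₀}`
  have hT : ∀ Ts : Finset (Fin (d + 1)),
      HasMaj (BlockNorm.ofBlocks (unitTorusGeo L k M) ((fun b : Tor (fine n M) × Fin (d + 1) => blockOf n M b.1)))
        (BlockNorm.ofBlocks (unitTorusGeo L k M) ((fun b : Tor (fine n M) × Fin (d + 1) => blockOf n M b.1)))
        (gradImg M n ν Ts (n : ℝ) ∘ₗ (gOp M n a ∘ₗ
          mulOp (chiInt M n c S)))
        (fun y y' => ind ((cubeBlocks M c S : Finset _) : Set _) y' * (C * Real.exp δ₀ * Real.exp (-(δ₀ * tdistT M y y')))) := by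
    intro Ts
    have h1 := hasMaj_comp_mulOp_chiInt (c := c) (S := S) hC.le hD
    -- `h1` is localized at the source; feed the unlocalized shape to `hasMaj_gradImg_comp` per source block
    intro y' μ hμ y
    by_cases hy' : y' ∈ cubeBlocks M c S
    · have hi : ind ((cubeBlocks M c S : Finset _) : Set _) y' = 1 := by simp [ind, hy']
      have hloc : HasMaj (BlockNorm.ofBlocks (unitTorusGeo L k M) ((fun b : Tor (fine n M) × Fin (d + 1) => blockOf n M b.1)))
          (BlockNorm.ofBlocks (unitTorusGeo L k M) ((fun b : Tor (fine n M) × Fin (d + 1) => blockOf n M b.1)))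
          (symbOp M n (sD M n ν (n : ℝ)) ∘ₗ
            (gOp M n a ∘ₗ mulOp (chiInt M n c S)))
          (fun y y' => C * Real.exp (-(δ₀ * tdistT M y y'))) := by
        -- the localized bound implies the unlocalized one only up to the indicator; we use it at THIS `y'` below instead
        intro z' μ' hμ' z
        have := h1 z' μ' hμ' z
        simp only [LinearMap.comp_apply] at this ⊢
        exact this.trans (mul_le_mul_of_nonneg_right (mul_le_of_le_one_left (mul_nonneg hC.le (Real.exp_nonneg _)) (ind_le_one _ _))
          ((BlockNorm.ofBlocks _ _).loc_nonneg z' μ'))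
      have h3 := hasMaj_gradImg_comp (L := L) (k := k) (T' := gOp M n a ∘ₗ mulOp (chiInt M n c S))
        (C := C) hC.le hδ₀.le ν Ts (n : ℝ) hloc
      have := h3 y' μ hμ y
      dsimp only at this ⊢
      rw [hi, one_mul]
      exact this
    · have hi : ind ((cubeBlocks M c S : Finset _) : Set _) y' = 0 := by simp [ind, hy']
      have hzero : mulOp (chiInt M n c S) μ = 0 := by
        funext b
        rw [mulOp_apply, Pi.zero_apply]
        by_cases hb : (fun b : Tor (fine n M) × Fin (d + 1) => blockOf n M b.1) b = y'
        · have : b ∉ intBonds M n c S := fun h => hy' (hb ▸ blockOf_mem_cubeBlocks h)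
          rw [chiInt_of_not_intBond this, zero_mul]
        · rw [hμ b hb, mul_zero]
      dsimp only
      rw [LinearMap.comp_apply, LinearMap.comp_apply, hzero, map_zero, map_zero, (BlockNorm.ofBlocks _ _).loc_zero, hi]
      simp
  have hsum := hasMaj_finsum (Finset.univ : Finset (Fin (d + 1))).powerset _ _ fun Ts _ =>
    hasMaj_chiCube_reflSet_comp (c := c) (S := S) (by positivity : (0 : ℝ) ≤ C * Real.exp δ₀) hδ₀.le hM Ts (hT Ts)
  rw [neumannCubeG, mulOp_comp_sD_comp_symOp_comp]
  refine hsum.mono fun y y' => le_of_eq ?_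
  rw [Finset.sum_const, Finset.card_powerset, Finset.card_univ, Fintype.card_fin, nsmul_eq_mul]
  push_cast
  ring

/-- ★★ **THE FINE MEMBER's ENTRY 1** (`χ′_□ ∘ ∇′_ν ∘ G′(□ + c)` for the Neumann cubes of the torus family at `n′ = L^r·L^k`, blocks through King's pairing), uniform in every index — the
cube entry dag-n15-c's commutator Leibniz (FILES 46∕52, `hK′`) reads at the fine spacing. [cite: Balaban1984PropagatorsII, (2.134) p.247 (shape); Balaban1984PropagatorsI, Prop. 1.2 (1.110) p.35] -/
theorem hasMaj_chiCube_grad_neumannCubeG_fine (hL : Odd L ∧ 1 < L) {a : ℝ} (ha : 0 < a) :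
    ∃ δ β : ℝ, 0 < δ ∧ 0 < β ∧ ∀ (mT k r : ℕ) (hk : 1 ≤ k) (c : Tor (MP (paramsOf d L mT k hL))) (ν : Fin (d + 1)),
      HasMaj (BlockNorm.ofBlocks (unitTorusGeo L k (MP (paramsOf d L mT k hL)))
          (fun i : Tor (fine (L ^ r * L ^ k) (MP (paramsOf d L mT k hL))) × Fin (d + 1) => blockOf (L ^ r * L ^ k) (MP (paramsOf d L mT k hL)) i.1))
        (BlockNorm.ofBlocks (unitTorusGeo L k (MP (paramsOf d L mT k hL)))
          (fun i : Tor (fine (L ^ r * L ^ k) (MP (paramsOf d L mT k hL))) × Fin (d + 1) => blockOf (L ^ r * L ^ k) (MP (paramsOf d L mT k hL)) i.1))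
        (mulOp (chiCube (MP (paramsOf d L mT k hL)) (L ^ r * L ^ k) c (L ^ mT)) ∘ₗ
          symbOp (MP (paramsOf d L mT k hL)) (L ^ r * L ^ k) (sD (MP (paramsOf d L mT k hL)) (L ^ r * L ^ k) ν ((L ^ r * L ^ k : ℕ) : ℝ)) ∘ₗ
          neumannCubeG (MP (paramsOf d L mT k hL)) (L ^ r * L ^ k) c (L ^ mT) a)
        (fun y y' => ind ((cubeBlocks (MP (paramsOf d L mT k hL)) c (L ^ mT) : Finset _) : Set _) y *
          ind ((cubeBlocks (MP (paramsOf d L mT k hL)) c (L ^ mT) : Finset _) : Set _) y' * (β * Real.exp (-(δ * tdistT (MP (paramsOf d L mT k hL)) y y')))) := by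
  obtain ⟨δ₀, C, Cα, Cε, Cαε, hδ₀, hC, H⟩ := ineq110_114_pair (d := d) hL ha
  refine ⟨δ₀, 2 ^ (d + 1) * (C * Real.exp δ₀ * Real.exp δ₀), hδ₀, by positivity, fun mT k r hk c ν => ?_⟩
  have hn' : 1 ≤ L ^ r * L ^ k := Nat.one_le_iff_ne_zero.mpr (Nat.mul_ne_zero (pow_ne_zero r (NeZero.ne L)) (pow_ne_zero k (NeZero.ne L)))
  exact hasMaj_chiCube_grad_neumannCubeG_of (fun μ => rfl) hC hδ₀ ν (hasMaj_grad_of_ineq (L := L) (k := k) _ _ a hn' (H mT k r hk).2 hC.le ν)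

/-- ★★★ **THE η-DEFECT LETTER OF THE NEUMANN CUBE PROPAGATORS AT `U ≡ 1`, HYPOTHESIS-FREE** (dag-n15-c FILE 45 `hasMaj_idef_parametrix` ∕ `hasMaj_idef_glued_of_cubes`, hypothesis `hDG`, with
`G_i := χ_□ ∘ G(□ + c)`, `S_i := □`'s blocks, `π := prV`): for odd `L ≥ 3`, `a > 0`, `0 < γ < 1` there are `δ, m > 0` such that for EVERY torus exponent `m_T`, coarse scale `k ≥ 1`,
refinement `r` and cube position `c`, `𝔇(G′_□, G_□) ≤ 1_□(y)·1_□(y′)·m·(L^k)^{−γ∕2}·e^{−δ|y−y′|_T}` — the η-RATE `(L^k)^{−γ∕2}` of King's Props. 3.8–3.9 for the torus pair (dag-n15-c part 52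
`hasMaj_twoGridDefect`) inherited by the cube propagators through the images, the faces costing `L^{−k} ≤ (L^k)^{−γ∕2}` ((1.110) gradient letter `hasMaj_entries110`).
[cite: Balaban1985BackgroundPropagators, Thm 3.14 pp.426–427, (3.42) p.397 (shape); King1986, Props. 3.8–3.9 pp.664–665 (A = 0 model); Balaban1984PropagatorsII, (2.37) p.229, (2.133) p.247] -/
theorem hasMaj_idef_chiCube_neumannCubeG (hLodd : Odd L) (hL2 : 2 ≤ L) {a : ℝ} (ha : 0 < a) {γ : ℝ} (hγ0 : 0 < γ) (hγ1 : γ < 1) :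
    ∃ δ m : ℝ, 0 < δ ∧ 0 < m ∧ ∀ (mT k r : ℕ) (hk : 1 ≤ k) (hL : Odd L ∧ 1 < L) (c : Tor (MP (paramsOf d L mT k hL))),
      HasMaj (BlockNorm.ofBlocks (unitTorusGeo L k (MP (paramsOf d L mT k hL))) (blkFine L k (MP (paramsOf d L mT k hL))))
        (BlockNorm.ofBlocks (unitTorusGeo L k (MP (paramsOf d L mT k hL)))
          (fun i : Tor (fine (L ^ r * L ^ k) (MP (paramsOf d L mT k hL))) × Fin (d + 1) => blockOf (L ^ r * L ^ k) (MP (paramsOf d L mT k hL)) i.1))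
        (idef (pull (kingPrV L k r (MP (paramsOf d L mT k hL)))) (pull (kingPrV L k r (MP (paramsOf d L mT k hL))))
          (mulOp (chiCube (MP (paramsOf d L mT k hL)) (L ^ r * L ^ k) c (L ^ mT)) ∘ₗ neumannCubeG (MP (paramsOf d L mT k hL)) (L ^ r * L ^ k) c (L ^ mT) a)
          (mulOp (chiCube (MP (paramsOf d L mT k hL)) (L ^ k) c (L ^ mT)) ∘ₗ neumannCubeG (MP (paramsOf d L mT k hL)) (L ^ k) c (L ^ mT) a))
        (fun y y' => ind ((cubeBlocks (MP (paramsOf d L mT k hL)) c (L ^ mT) : Finset _) : Set _) y *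
          ind ((cubeBlocks (MP (paramsOf d L mT k hL)) c (L ^ mT) : Finset _) : Set _) y' *
          (m * ((L ^ k : ℕ) : ℝ) ^ (-(γ / 2)) * Real.exp (-(δ * tdistT (MP (paramsOf d L mT k hL)) y y')))) := by
  have hL : Odd L ∧ 1 < L := ⟨hLodd, by omega⟩
  obtain ⟨δ₀, C₀, hδ₀, hC₀, H0⟩ := hasMaj_twoGridDefect (d := d) hLodd hL2 ha hγ0 hγ1
  obtain ⟨δ₁, C₁, hδ₁, hC₁, H1⟩ := hasMaj_entries110 (d := d) hL ha
  refine ⟨min δ₀ δ₁, 2 ^ (d + 1) * Real.exp (min δ₀ δ₁) * (C₀ + (d + 1) * C₁), lt_min hδ₀ hδ₁, by positivity, fun mT k r hk hL' c => ?_⟩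
  set δ := min δ₀ δ₁ with hδdef
  have hM : ∀ ν, MP (paramsOf d L mT k hL') ν = 2 * L ^ mT := fun ν => rfl
  have hn1 : 1 ≤ L ^ k := Nat.one_le_pow _ _ (by omega)
  have hnr1 : (1 : ℝ) ≤ ((L ^ k : ℕ) : ℝ) := by exact_mod_cast hn1
  have hnr0 : (0 : ℝ) < ((L ^ k : ℕ) : ℝ) := by linarith
  set ρ : ℝ := ((L ^ k : ℕ) : ℝ) ^ (-(γ / 2)) with hρdef
  have hρ0 : 0 ≤ ρ := Real.rpow_nonneg hnr0.le _
  -- the two letters at this index, decay weakened to `δ`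
  have h0 := hasMaj_rate_mono (A := C₀ * ρ) (by positivity) (min_le_left δ₀ δ₁) (H0 mT k r hk hL')
  have h1 := fun ν => hasMaj_rate_mono hC₁.le (min_le_right δ₀ δ₁) (H1 mT k hk ν).1
  have hmain := hasMaj_idef_chiCube_neumannCubeG_of (r := r) (c := c) hM ha (by positivity : 0 ≤ C₀ * ρ) hC₁.le (le_min hδ₀.le hδ₁.le) h0 h1
  refine hmain.mono fun y y' => ?_
  -- `L^{−k} ≤ (L^k)^{−γ∕2}`
  have hinv : (C₁ / ((L ^ k : ℕ) : ℝ)) ≤ C₁ * ρ := by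
    rw [div_eq_mul_inv, ← Real.rpow_neg_one]
    exact mul_le_mul_of_nonneg_left (Real.rpow_le_rpow_of_exponent_le hnr1 (by linarith)) hC₁.le
  have hcoef : 2 ^ (d + 1) * Real.exp δ * (C₀ * ρ + (d + 1) * (C₁ / ((L ^ k : ℕ) : ℝ))) ≤ 2 ^ (d + 1) * Real.exp δ * (C₀ + (d + 1) * C₁) * ρ := by
    have h2 : 0 ≤ 2 ^ (d + 1) * Real.exp δ * (d + 1) * (C₁ * ρ - C₁ / ((L ^ k : ℕ) : ℝ)) := mul_nonneg (by positivity) (sub_nonneg.mpr hinv)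
    nlinarith [h2]
  exact mul_le_mul_of_nonneg_left (mul_le_mul_of_nonneg_right hcoef (Real.exp_nonneg _)) (mul_nonneg (ind_nonneg _ _) (ind_nonneg _ _))

end Letters

end Summit.QuantumFields.YangMills.BalabanUVNodes.N15.TwoGrid
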